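import Literature.Computability.QuantumComplexity.CircuitEmbedding
import HarnessLib

/-!
# Block states with a classical rest (one block of a register)

First of two infrastructure files for the analysis of a quantum subroutine run on a block of
wires `E : Fin b ↪ Fin W` of a larger register whose other wires hold *classical* data
(Bennett's compute–copy–uncompute around a quantum subroutine; Bernstein–Vazirani 1997, §8;
Bennett–Bernstein–Brassard–Vazirani 1997, Thm. 4.14; Nielsen–Chuang 2010, §2.1.7, §4.4). This
file is the one-block specialisation of the product states of `CircuitEmbedding.lean`
(`prodState`, there for `m` equal blocks), in the vocabulary used by the sequel
`UncomputeBranches.lean`: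

* `AgreeOff E z c` — the registers `z`, `c` agree off the block; the algebra of
  `Function.extend E f c` (the register `c` with block content `f`): `extend_eq_iff`,
  `extend_extend`, `agreeOff_extend_left_iff`, `sum_ite_agreeOff_eq_sum_extend`;
* `restBlockState E φ c = |c|_{off E}⟩ ⊗ |φ⟩_E` (named so as not to shadow
  `RazTalMachine.blockState` of this topic) and the link
  **`restBlockState_eq_prodState`**: it is `prodState (fun _ : Fin 1 => E) (fun _ => φ) c`;
* `placeGate_mulVec_restBlockState` (an operator placed on the block acts on the block factor;
  derived from `placeGate_mulVec_prodState`), `sum_normSq_restBlockState` (from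
  `sum_normSq_prodState_mul`), `restBlockState_basisState`, `restBlockState_eq_sum`.

## References

* M. A. Nielsen, I. L. Chuang, *Quantum Computation and Quantum Information*, CUP 2010,
  §2.1.7 eq. (2.45), §2.2.8.
* E. Bernstein, U. Vazirani, *Quantum complexity theory*, SIAM J. Comput. 26 (1997), §8.
-/

noncomputable section

open Matrix

namespace Literature.Computability.QuantumComplexity

open Cryptography

open scoped Classical

variable {b W : ℕ}

/-! ### Registers agreeing off a block; writing the block -/

/-- `AgreeOff E z c`: the registers `z` and `c` agree on every wire outside the block `E`.
[folklore] -/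
def AgreeOff (E : Fin b ↪ Fin W) (z c : QReg W) : Prop := ∀ w, w ∉ Set.range E → z w = c w

section Agree

variable (E : Fin b ↪ Fin W)

/-- Unfolding `AgreeOff`. [folklore] -/
theorem agreeOff_iff (z c : QReg W) : AgreeOff E z c ↔ ∀ w, w ∉ Set.range E → z w = c w := Iff.rfl

/-- `AgreeOff` is reflexive. [folklore] -/
theorem agreeOff_refl (z : QReg W) : AgreeOff E z z := fun _ _ => rfl

/-- `AgreeOff` is symmetric. [folklore] -/
theorem AgreeOff.symm {z c : QReg W} (h : AgreeOff E z c) : AgreeOff E c z := fun w hw => (h w hw).symm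

/-- `AgreeOff` is transitive. [folklore] -/
theorem AgreeOff.trans {z c d : QReg W} (h : AgreeOff E z c) (h' : AgreeOff E c d) : AgreeOff E z d :=
  fun w hw => (h w hw).trans (h' w hw)

/-- Writing the block does not change the rest. [folklore] -/
theorem agreeOff_extend (f : QReg b) (c : QReg W) : AgreeOff E (Function.extend E f c) c :=
  fun _ hw => extend_apply_of_not_mem E f c hw

/-- A register is its rest with its own block content written in. [folklore] -/
theorem extend_restrict_of_agreeOff {z c : QReg W} (h : AgreeOff E z c) :
    Function.extend E (z ∘ E) c = z := by
  funext w
  by_cases hw : w ∈ Set.range E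
  · obtain ⟨i, rfl⟩ := hw
    exact E.injective.extend_apply _ _ i
  · rw [extend_apply_of_not_mem E _ _ hw, h w hw]

/-- `extend E (z ∘ E) z = z`. [folklore] -/
@[simp] theorem extend_restrict_self (z : QReg W) : Function.extend E (z ∘ E) z = z :=
  extend_restrict_of_agreeOff E (agreeOff_refl E z)

/-- **Characterisation of the written register**: `extend E f c = z` iff `z` has block content
`f` and agrees with `c` off the block. [folklore] -/
theorem extend_eq_iff (f : QReg b) (c z : QReg W) :
    Function.extend E f c = z ↔ z ∘ E = f ∧ AgreeOff E z c := by
  constructor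
  · rintro rfl
    exact ⟨extend_comp_embedding E f c, agreeOff_extend E f c⟩
  · rintro ⟨hf, hz⟩
    rw [← hf]
    exact extend_restrict_of_agreeOff E hz

/-- Writing the block twice keeps the last content. [folklore] -/
theorem extend_extend (f g : QReg b) (c : QReg W) :
    Function.extend E f (Function.extend E g c) = Function.extend E f c := by
  funext w
  by_cases hw : w ∈ Set.range E
  · obtain ⟨i, rfl⟩ := hw
    rw [E.injective.extend_apply, E.injective.extend_apply]
  · rw [extend_apply_of_not_mem E _ _ hw, extend_apply_of_not_mem E _ _ hw,
      extend_apply_of_not_mem E _ _ hw]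

/-- A written register agrees off the block with `z` iff the underlying rest does. [folklore] -/
theorem agreeOff_extend_left_iff (f : QReg b) (c z : QReg W) :
    AgreeOff E (Function.extend E f c) z ↔ AgreeOff E c z := by
  refine ⟨fun h w hw => ?_, fun h w hw => ?_⟩
  · rw [← extend_apply_of_not_mem E f c hw]; exact h w hw
  · rw [extend_apply_of_not_mem E f c hw]; exact h w hw

/-- Writing the block is injective in the content (Mathlib's `Function.extend_injective`,
recorded under the vocabulary of this file). [folklore] -/
theorem extend_left_injective (c : QReg W) : Function.Injective fun f : QReg b => Function.extend E f c :=
  Function.extend_injective E.injective c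

/-- **Sums over the registers agreeing with `c` off the block** are sums over block contents
(`sum_ite_agree_eq_sum_extend` of `ForrelationThm25Amplitude.lean`, restated with `AgreeOff`).
[folklore] -/
theorem sum_ite_agreeOff_eq_sum_extend {M : Type*} [AddCommMonoid M] (c : QReg W) (Φ : QReg W → M) :
    (∑ z, if AgreeOff E z c then Φ z else 0) = ∑ f, Φ (Function.extend E f c) := by
  rw [← sum_ite_agree_eq_sum_extend E c Φ]
  refine Finset.sum_congr rfl fun z _ => ?_
  exact if_congr Iff.rfl rfl rfl

end Agree

/-! ### Block states -/

/-- **Block state with a classical rest**: `|c|_{off E}⟩ ⊗ |φ⟩_E`, the state whose amplitude at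
`z` is `φ(z|_E)` if `z` agrees with `c` off the block and `0` otherwise — the case `m = 1` of
`prodState` (`restBlockState_eq_prodState`). Named `restBlockState` (block state with a
classical *rest*) so as not to shadow `RazTalMachine.blockState`. [Nielsen–Chuang 2010, §2.1.7]
[cite: NielsenChuang2010, §2.1.7] -/
def restBlockState (E : Fin b ↪ Fin W) (φ : QReg b → ℂ) (c : QReg W) : QReg W → ℂ :=
  fun z => if AgreeOff E z c then φ (z ∘ E) else 0

section Block

variable (E : Fin b ↪ Fin W)

/-- Amplitudes of a block state (definitional). [folklore] -/
theorem restBlockState_apply (φ : QReg b → ℂ) (c z : QReg W) :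
    restBlockState E φ c z = if AgreeOff E z c then φ (z ∘ E) else 0 := rfl

/-- Agreeing off the single block `E` (as a family over `Fin 1`) is `AgreeOff E`. [folklore] -/
theorem forall_offBlocks_const_iff (z c : QReg W) :
    (∀ w, OffBlocks (fun _ : Fin 1 => E) w → z w = c w) ↔ AgreeOff E z c :=
  ⟨fun h w hw => h w fun _ => hw, fun h w hw => h w (hw 0)⟩

/-- The one-block family is (vacuously) block-disjoint. [folklore] -/
theorem blockDisjoint_const : BlockDisjoint (fun _ : Fin 1 => E) :=
  fun i j hij => absurd (Subsingleton.elim i j) hij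

/-- **Link with `CircuitEmbedding.prodState`**: a block state with a classical rest is the
product state of the one-block family `Fin 1 ↦ E`. [Nielsen–Chuang 2010, §2.1.7]
[cite: NielsenChuang2010, §2.1.7] -/
theorem restBlockState_eq_prodState (φ : QReg b → ℂ) (c : QReg W) :
    restBlockState E φ c = prodState (fun _ : Fin 1 => E) (fun _ => φ) c := by
  funext z
  rw [prodState_apply, Fin.prod_univ_one, restBlockState_apply]
  by_cases hz : AgreeOff E z c
  · rw [if_pos hz, if_pos ((forall_offBlocks_const_iff E z c).2 hz), one_mul]
  · rw [if_neg hz, if_neg (mt (forall_offBlocks_const_iff E z c).1 hz), zero_mul]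

/-- The block state only depends on the rest of `c`. [folklore] -/
theorem restBlockState_congr {c c' : QReg W} (h : AgreeOff E c c') (φ : QReg b → ℂ) :
    restBlockState E φ c = restBlockState E φ c' := by
  funext z
  simp only [restBlockState_apply]
  by_cases hz : AgreeOff E z c
  · rw [if_pos hz, if_pos (hz.trans E h)]
  · rw [if_neg hz, if_neg fun hz' => hz (hz'.trans E (h.symm E))]

/-- **A basis block gives a basis state**: `|c|_{off}⟩ ⊗ |f⟩ = |c with block f⟩`. [folklore] -/
theorem restBlockState_basisState (f : QReg b) (c : QReg W) :
    restBlockState E (basisState f) c = basisState (Function.extend E f c) := by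
  funext z
  simp only [restBlockState_apply, basisState_apply]
  by_cases h : AgreeOff E z c
  · rw [if_pos h]
    by_cases hz : z ∘ E = f
    · rw [if_pos hz, if_pos ((extend_eq_iff E f c z).2 ⟨hz, h⟩).symm]
    · rw [if_neg hz, if_neg fun heq => hz ((extend_eq_iff E f c z).1 heq.symm).1]
  · rw [if_neg h, if_neg fun heq => h ((extend_eq_iff E f c z).1 heq.symm).2]

/-- A basis state is the block state of its own block content. [folklore] -/
theorem basisState_eq_restBlockState (c : QReg W) :
    basisState c = restBlockState E (basisState (c ∘ E)) c := by
  rw [restBlockState_basisState, extend_restrict_self]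

/-- **A block state is the superposition of the basis states of its branches.** [folklore] -/
theorem restBlockState_eq_sum (φ : QReg b → ℂ) (c : QReg W) :
    restBlockState E φ c = ∑ f, φ f • basisState (Function.extend E f c) := by
  funext z
  simp only [Finset.sum_apply, Pi.smul_apply, smul_eq_mul]
  simp_rw [← restBlockState_basisState]
  simp only [restBlockState_apply, basisState_apply]
  by_cases h : AgreeOff E z c
  · simp only [if_pos h, mul_ite, mul_one, mul_zero]
    rw [Finset.sum_ite_eq]
    simp
  · simp [if_neg h]

/-- **An operator placed on the block acts on the block factor**:
`(U)_E (|c⟩ ⊗ |φ⟩) = |c⟩ ⊗ U|φ⟩` — the case `m = 1` of the frame rule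
`placeGate_mulVec_prodState`, from which it is derived (the basis-block instance is also
`RazTalBlocks.placeGate_mulVec_basisState`). [Nielsen–Chuang 2010, §2.1.7, eq. (2.45)]
[cite: NielsenChuang2010, §2.1.7 eq. (2.45)] -/
theorem placeGate_mulVec_restBlockState (U : Matrix (QReg b) (QReg b) ℂ) (φ : QReg b → ℂ) (c : QReg W) :
    placeGate E U *ᵥ restBlockState E φ c = restBlockState E (U *ᵥ φ) c := by
  rw [restBlockState_eq_prodState, restBlockState_eq_prodState,
    placeGate_mulVec_prodState (blockDisjoint_const E) (0 : Fin 1) U (fun _ => φ) c]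
  congr 1
  funext i
  rw [Subsingleton.elim i 0, Function.update_self]

/-- The squared norm of a block state is that of its block factor (the case `m = 1`, `g = 1`
of `sum_normSq_prodState_mul`, from which it is derived). [Nielsen–Chuang 2010, §2.2.8]
[cite: NielsenChuang2010, §2.2.8] -/
theorem sum_normSq_restBlockState (φ : QReg b → ℂ) (c : QReg W) :
    ∑ z, ‖restBlockState E φ c z‖ ^ 2 = ∑ f, ‖φ f‖ ^ 2 := by
  have h := sum_normSq_prodState_mul (blockDisjoint_const E) (fun _ => φ) c fun _ => 1
  simp only [mul_one, Fin.prod_univ_one] at h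
  rw [restBlockState_eq_prodState, h]
  exact Fintype.sum_equiv (Equiv.funUnique (Fin 1) (QReg b)) _ _ fun y => rfl

end Block

end Literature.Computability.QuantumComplexity
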